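import Summits.CriticalPhenomena.PercolationContinuityZ3.Theorems.PercNearOneGluingNoHeavyQuantIndepBlobGateRaise
import Summits.CriticalPhenomena.PercolationContinuityZ3.Theorems.PercNearOneGluingNoHeavyQuantIndepBlobThinning
import HarnessLib

/-!
# QUANT lane R8, blob lemma (U): the Bernstein (form-F) group raise

builds on p205010 (kernel theorem, internal audit signed; external expert review pending)

Support file (`--supports stmt-CriticalPhenomena-4575`), QUANT lane seat prim-quant-census-1 (gen 12); memo
`run/shared/lean/prim/quant/prim-quant-census-1/U-REDUCTIONS-G12.md` §1–§2 (reduction R2).  Theorems only; no sorries; standard axioms.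

Setting of `…QuantIndepBlobGateRaise`.  Fix a finset `G` of blobs (in applications: the tie group at the least gate) and put all their gates at a
common value `u`, the other gates being those of `p` (`gateOn G p u`).  Conditioning on `G`,
  `P_u(y ≤ W) = Σ_{S ⊆ G} u^{#S} (1−u)^{#G−#S} Φ(S)`,   `Φ(S) = P(y ≤ a(S) + a(T))` over the configurations `T` of the other blobs,
and `u = Σ_{S ⊆ G} u^{#S}(1−u)^{#G−#S}·#S/#G`, so that with `s = u/(1−u)` and the LEVEL SUMS `C_n = Σ_{S ⊆ G, #S = n} (Φ(S) − n/#G)`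
  `P_u(y ≤ W) − u = (1−u)^{#G} · Σ_n C_n s^n`.
If `(C_n)` is FORM F (nonnegative for `n ≤ n⋆`, nonpositive for `n > n⋆`) then `Σ_n C_n s^n / s^{n⋆}` is non-increasing in `s > 0`, hence a lower bound
`θ ≤ P_θ(y ≤ W)` after raising the common gate to `θ ≥ t` gives `t ≤ P_t(y ≤ W)` before (`group_raise`).  For `#G = 1` this is the K3 raise and for
`#G = 2` the pair raise (form F is automatic there); for the tie group of a configuration satisfying (U)'s hypotheses it reduces (U) to the configuration
with the whole group raised to the next gate level whenever the level sums are form F (U-REDUCTIONS-G12 §2, §4: with R1/R3/R4 this settles every tested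
configuration).
* `sum_weight_set_split` — conditioning the product weight on a finset of coordinates.
* `gateOn_weight_eq`, `tail_eq_group_expansion`, `sum_groupWeight_mul_card` (the mean identity), `tail_sub_gate_eq_levelSum`.
* `levelSum_ratio_mono` — the monotone-ratio lemma for form-F coefficient sequences.
* `group_raise`.
[this work]
-/

namespace Summit.CriticalPhenomena.PercolationContinuityZ3.Theorems

namespace Quant

namespace IndepBlob

open Finset

variable {κ : Type*} [Fintype κ] [DecidableEq κ]

/-- Conditioning the product weight on a finset `G` of coordinates:
`Σ_s w(s) F(s) = Σ_{S ⊆ G} Σ_{T ⊆ univ∖G} w_G(S)·w_{univ∖G}(T)·F(S ∪ T)`. [folklore] -/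
theorem sum_weight_set_split (q : κ → ℝ) (G : Finset κ) (F : Finset κ → ℝ) :
    ∑ s : Finset κ, (∏ k, if k ∈ s then q k else 1 - q k) * F s =
      ∑ S ∈ G.powerset, ∑ T ∈ (Finset.univ \ G).powerset,
        (∏ k ∈ G, if k ∈ S then q k else 1 - q k) *
          ((∏ k ∈ Finset.univ \ G, if k ∈ T then q k else 1 - q k) * F (S ∪ T)) := by
  induction G using Finset.induction_on generalizing F with
  | empty =>
    rw [Finset.powerset_empty, Finset.sum_singleton, Finset.sdiff_empty, Finset.powerset_univ, Finset.prod_empty]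
    refine Finset.sum_congr rfl fun T _ => ?_
    rw [one_mul, Finset.empty_union]
  | @insert g G hgG ih =>
    -- left side, via the induction hypothesis, then split the complement sum at `g`
    have hgC : g ∈ Finset.univ \ G := Finset.mem_sdiff.2 ⟨Finset.mem_univ _, hgG⟩
    have hC' : (Finset.univ \ G).erase g = Finset.univ \ insert g G := by
      ext k
      simp only [Finset.mem_erase, Finset.mem_sdiff, Finset.mem_univ, true_and, Finset.mem_insert, not_or]
    rw [ih F]
    have inner : ∀ S : Finset κ, ∑ T ∈ (Finset.univ \ G).powerset,
        (∏ k ∈ G, if k ∈ S then q k else 1 - q k) *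
          ((∏ k ∈ Finset.univ \ G, if k ∈ T then q k else 1 - q k) * F (S ∪ T)) =
        q g * ∑ T ∈ (Finset.univ \ insert g G).powerset,
          (∏ k ∈ Finset.univ \ insert g G, if k ∈ T then q k else 1 - q k) *
            ((∏ k ∈ G, if k ∈ S then q k else 1 - q k) * F (S ∪ insert g T)) +
        (1 - q g) * ∑ T ∈ (Finset.univ \ insert g G).powerset,
          (∏ k ∈ Finset.univ \ insert g G, if k ∈ T then q k else 1 - q k) *
            ((∏ k ∈ G, if k ∈ S then q k else 1 - q k) * F (S ∪ T)) := by
      intro S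
      have h := sum_weight_powerset_split q (Finset.univ \ G) hgC
        (fun T => (∏ k ∈ G, if k ∈ S then q k else 1 - q k) * F (S ∪ T))
      rw [hC'] at h
      have e : ∀ T : Finset κ, (∏ k ∈ G, if k ∈ S then q k else 1 - q k) *
          ((∏ k ∈ Finset.univ \ G, if k ∈ T then q k else 1 - q k) * F (S ∪ T)) =
          (∏ k ∈ Finset.univ \ G, if k ∈ T then q k else 1 - q k) *
            ((∏ k ∈ G, if k ∈ S then q k else 1 - q k) * F (S ∪ T)) := fun T => by ring
      rw [Finset.sum_congr rfl fun T _ => e T, h]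
    rw [Finset.sum_congr rfl fun S _ => inner S]
    -- right side: split the sum over subsets of `insert g G` at `g`
    have outer := sum_weight_powerset_split q (insert g G) (Finset.mem_insert_self g G)
      (fun S => ∑ T ∈ (Finset.univ \ insert g G).powerset,
        (∏ k ∈ Finset.univ \ insert g G, if k ∈ T then q k else 1 - q k) * F (S ∪ T))
    rw [Finset.erase_insert hgG] at outer
    have e2 : ∀ S : Finset κ, (∏ k ∈ insert g G, if k ∈ S then q k else 1 - q k) *
        ∑ T ∈ (Finset.univ \ insert g G).powerset,
          (∏ k ∈ Finset.univ \ insert g G, if k ∈ T then q k else 1 - q k) * F (S ∪ T) =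
        ∑ T ∈ (Finset.univ \ insert g G).powerset, (∏ k ∈ insert g G, if k ∈ S then q k else 1 - q k) *
          ((∏ k ∈ Finset.univ \ insert g G, if k ∈ T then q k else 1 - q k) * F (S ∪ T)) := by
      intro S
      rw [Finset.mul_sum]
    rw [← Finset.sum_congr rfl fun S _ => e2 S, outer]
    -- compare term by term
    rw [Finset.sum_add_distrib, ← Finset.mul_sum, ← Finset.mul_sum]
    congr 1
    · congr 1
      refine Finset.sum_congr rfl fun S _ => ?_
      rw [Finset.mul_sum]
      refine Finset.sum_congr rfl fun T _ => ?_
      rw [Finset.union_insert, Finset.insert_union]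
      ring
    · congr 1
      refine Finset.sum_congr rfl fun S _ => ?_
      rw [Finset.mul_sum]
      refine Finset.sum_congr rfl fun T _ => ?_
      ring

omit [Fintype κ] in
/-- The product weight on `G` when every gate of `G` equals `u`: `Π_{k∈G} (u if k ∈ S else 1−u) = u^{#S} (1−u)^{#G − #S}` for `S ⊆ G`. [folklore] -/
theorem groupWeight_eq_pow (G S : Finset κ) (hS : S ⊆ G) (u : ℝ) :
    (∏ k ∈ G, if k ∈ S then u else 1 - u) = u ^ S.card * (1 - u) ^ (G.card - S.card) := by
  rw [Finset.prod_ite, Finset.prod_const, Finset.prod_const]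
  have h1 : G.filter (fun k => k ∈ S) = S := by
    ext k; simp only [Finset.mem_filter]; exact ⟨fun h => h.2, fun h => ⟨hS h, h⟩⟩
  have h2 : (G.filter (fun k => ¬ k ∈ S)).card = G.card - S.card := by
    have : G.filter (fun k => ¬ k ∈ S) = G \ S := by
      ext k; simp only [Finset.mem_filter, Finset.mem_sdiff]
    rw [this, Finset.card_sdiff_of_subset hS]
  rw [h1, h2]

/-- **Conditioning the tail on a group of blobs with a common gate.**  With the gates of `G` set to `u` (others those of `p`),
`P(y ≤ W) = Σ_{S ⊆ G} u^{#S}(1−u)^{#G−#S} · Φ(S)`, `Φ(S) = Σ_{T ⊆ univ∖G : y ≤ a(S) + a(T)} w_{univ∖G}(T)`. [this work] -/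
theorem tail_eq_group_expansion (p : κ → ℝ) (a : κ → ℕ) (G : Finset κ) (u : ℝ) (y : ℕ) :
    ∑ s ∈ (Finset.univ : Finset (Finset κ)).filter (fun s => y ≤ ∑ k ∈ s, a k),
        (∏ k, if k ∈ s then (fun k => if k ∈ G then u else p k) k else 1 - (fun k => if k ∈ G then u else p k) k) =
      ∑ S ∈ G.powerset, u ^ S.card * (1 - u) ^ (G.card - S.card) *
        ∑ T ∈ ((Finset.univ \ G).powerset).filter (fun T => y ≤ ∑ k ∈ S, a k + ∑ k ∈ T, a k),
          (∏ k ∈ Finset.univ \ G, if k ∈ T then p k else 1 - p k) := by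
  set q : κ → ℝ := fun k => if k ∈ G then u else p k with hq
  rw [Finset.sum_filter]
  have e1 : ∀ s : Finset κ, (if y ≤ ∑ k ∈ s, a k then (∏ k, if k ∈ s then q k else 1 - q k) else 0) =
      (∏ k, if k ∈ s then q k else 1 - q k) * (if y ≤ ∑ k ∈ s, a k then (1 : ℝ) else 0) := fun s => by
    split_ifs <;> simp
  rw [Finset.sum_congr rfl fun s _ => e1 s, sum_weight_set_split q G]
  refine Finset.sum_congr rfl fun S hS => ?_
  have hSG : S ⊆ G := Finset.mem_powerset.1 hS
  -- the `G`-weight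
  have hwG : (∏ k ∈ G, if k ∈ S then q k else 1 - q k) = u ^ S.card * (1 - u) ^ (G.card - S.card) := by
    rw [← groupWeight_eq_pow G S hSG u]
    refine Finset.prod_congr rfl fun k hk => ?_
    have : q k = u := by rw [hq]; exact if_pos hk
    rw [this]
  rw [hwG, Finset.sum_filter, Finset.mul_sum]
  refine Finset.sum_congr rfl fun T hT => ?_
  have hTC : T ⊆ Finset.univ \ G := Finset.mem_powerset.1 hT
  -- the complement weight
  have hwC : (∏ k ∈ Finset.univ \ G, if k ∈ T then q k else 1 - q k) =
      ∏ k ∈ Finset.univ \ G, (if k ∈ T then p k else 1 - p k) := by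
    refine Finset.prod_congr rfl fun k hk => ?_
    have hkG : k ∉ G := (Finset.mem_sdiff.1 hk).2
    have : q k = p k := by rw [hq]; exact if_neg hkG
    rw [this]
  -- disjointness of `S` and `T`
  have hdisj : Disjoint S T := by
    rw [Finset.disjoint_left]
    intro k hkS hkT
    exact (Finset.mem_sdiff.1 (hTC hkT)).2 (hSG hkS)
  have hsum : ∑ k ∈ S ∪ T, a k = ∑ k ∈ S, a k + ∑ k ∈ T, a k := Finset.sum_union hdisj
  rw [hwC, hsum]
  split_ifs <;> simp

omit [Fintype κ] in
/-- The mean identity on the group: `Σ_{S ⊆ G} u^{#S}(1−u)^{#G−#S}·#S = #G · u`. [folklore] -/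
theorem sum_groupWeight_mul_card (G : Finset κ) (u : ℝ) :
    ∑ S ∈ G.powerset, u ^ S.card * (1 - u) ^ (G.card - S.card) * (S.card : ℝ) = (G.card : ℝ) * u := by
  -- `#S = Σ_{g ∈ G} 1_{g ∈ S}` and each marginal is `u`
  have hcard : ∀ S ∈ G.powerset, (S.card : ℝ) = ∑ g ∈ G, (if g ∈ S then (1 : ℝ) else 0) := by
    intro S hS
    rw [Finset.sum_boole, Nat.cast_inj]
    congr 1
    ext k; simp only [Finset.mem_filter]
    exact ⟨fun h => ⟨Finset.mem_powerset.1 hS h, h⟩, fun h => h.2⟩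
  have hmarg : ∀ g ∈ G, ∑ S ∈ G.powerset, (∏ k ∈ G, if k ∈ S then u else 1 - u) * (if g ∈ S then (1 : ℝ) else 0) = u := by
    intro g hg
    rw [sum_weight_powerset_split (fun _ => u) G hg, Finset.sum_eq_zero (s := (G.erase g).powerset)
      (f := fun t => (∏ k ∈ G.erase g, if k ∈ t then u else 1 - u) * (if g ∈ t then (1 : ℝ) else 0))
      (fun t ht => by
        have : g ∉ t := fun h => Finset.notMem_erase g G (Finset.mem_powerset.1 ht h)
        rw [if_neg this, mul_zero])]
    have h1 : ∑ t ∈ (G.erase g).powerset, (∏ k ∈ G.erase g, if k ∈ t then u else 1 - u) * (if g ∈ insert g t then (1 : ℝ) else 0) =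
        ∑ t ∈ (G.erase g).powerset, (∏ k ∈ G.erase g, if k ∈ t then u else 1 - u) :=
      Finset.sum_congr rfl fun t _ => by rw [if_pos (Finset.mem_insert_self g t), mul_one]
    rw [h1, sum_powerset_prod_ite_mem]
    simp
  calc ∑ S ∈ G.powerset, u ^ S.card * (1 - u) ^ (G.card - S.card) * (S.card : ℝ)
      = ∑ S ∈ G.powerset, ∑ g ∈ G, (∏ k ∈ G, if k ∈ S then u else 1 - u) * (if g ∈ S then (1 : ℝ) else 0) := by
        refine Finset.sum_congr rfl fun S hS => ?_
        rw [hcard S hS, Finset.mul_sum, groupWeight_eq_pow G S (Finset.mem_powerset.1 hS) u]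
    _ = ∑ g ∈ G, ∑ S ∈ G.powerset, (∏ k ∈ G, if k ∈ S then u else 1 - u) * (if g ∈ S then (1 : ℝ) else 0) := Finset.sum_comm
    _ = ∑ g ∈ G, u := Finset.sum_congr rfl hmarg
    _ = (G.card : ℝ) * u := by rw [Finset.sum_const, nsmul_eq_mul]

/-- **The monotone-ratio lemma for form-F coefficients.**  If `C n ≥ 0` for `n ≤ n⋆` and `C n ≤ 0` for `n > n⋆`, then for `0 < s₀ ≤ s₁`:
`s₀^{n⋆} · Σ_{n ≤ N} C n s₁^n ≤ s₁^{n⋆} · Σ_{n ≤ N} C n s₀^n`. [this work] -/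
theorem levelSum_ratio_mono (C : ℕ → ℝ) (N nstar : ℕ) (hpos : ∀ n, n ≤ nstar → 0 ≤ C n)
    (hneg : ∀ n, nstar < n → C n ≤ 0) {s₀ s₁ : ℝ} (hs₀ : 0 < s₀) (hs : s₀ ≤ s₁) :
    s₀ ^ nstar * ∑ n ∈ Finset.range (N + 1), C n * s₁ ^ n ≤ s₁ ^ nstar * ∑ n ∈ Finset.range (N + 1), C n * s₀ ^ n := by
  rw [Finset.mul_sum, Finset.mul_sum]
  refine Finset.sum_le_sum fun n _ => ?_
  have hs₁ : 0 < s₁ := lt_of_lt_of_le hs₀ hs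
  by_cases hn : n ≤ nstar
  · -- `C n ≥ 0`, compare `s₀^{n⋆} s₁^n ≤ s₁^{n⋆} s₀^n`, i.e. `s₁^{n⋆−n} ≥ s₀^{n⋆−n}` after factoring `(s₀ s₁)^n`
    obtain ⟨d, rfl⟩ := Nat.exists_eq_add_of_le hn
    have key : s₀ ^ (n + d) * s₁ ^ n ≤ s₁ ^ (n + d) * s₀ ^ n := by
      rw [pow_add, pow_add]
      have h1 : s₀ ^ d ≤ s₁ ^ d := pow_le_pow_left₀ (le_of_lt hs₀) hs d
      have h2 : 0 ≤ s₀ ^ n * s₁ ^ n := by positivity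
      nlinarith [h1, h2]
    have := mul_le_mul_of_nonneg_left key (hpos n hn)
    nlinarith [this]
  · push Not at hn
    obtain ⟨d, rfl⟩ := Nat.exists_eq_add_of_le (le_of_lt hn)
    have key : s₁ ^ nstar * s₀ ^ (nstar + d) ≤ s₀ ^ nstar * s₁ ^ (nstar + d) := by
      rw [pow_add, pow_add]
      have h1 : s₀ ^ d ≤ s₁ ^ d := pow_le_pow_left₀ (le_of_lt hs₀) hs d
      have h2 : 0 ≤ s₀ ^ nstar * s₁ ^ nstar := by positivity
      nlinarith [h1, h2]
    have hC := hneg (nstar + d) hn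
    nlinarith [key, hC]

/-- **The tail minus the common gate, as a Bernstein/level-sum polynomial.**  With the gates of `G` set to `u < 1`, `k = #G`,
`s = u/(1−u)`, `Φ` as in `tail_eq_group_expansion` and `C_n = Σ_{S ⊆ G, #S = n} (Φ(S) − n/k)`:
`P_u(y ≤ W) − u = (1−u)^k · Σ_{n ≤ k} C_n s^n` (for `G` nonempty). [this work] -/
theorem tail_sub_gate_eq_levelSum (p : κ → ℝ) (a : κ → ℕ) (G : Finset κ) (hG : G.Nonempty) (u : ℝ) (hu : u < 1) (y : ℕ) :
    ∑ s ∈ (Finset.univ : Finset (Finset κ)).filter (fun s => y ≤ ∑ k ∈ s, a k),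
        (∏ k, if k ∈ s then (fun k => if k ∈ G then u else p k) k else 1 - (fun k => if k ∈ G then u else p k) k) - u =
      (1 - u) ^ G.card * ∑ n ∈ Finset.range (G.card + 1),
        (∑ S ∈ G.powersetCard n,
          (∑ T ∈ ((Finset.univ \ G).powerset).filter (fun T => y ≤ ∑ k ∈ S, a k + ∑ k ∈ T, a k),
              (∏ k ∈ Finset.univ \ G, if k ∈ T then p k else 1 - p k) - (n : ℝ) / G.card)) *
          (u / (1 - u)) ^ n := by
  have hk : (0 : ℝ) < G.card := by exact_mod_cast hG.card_pos
  rw [tail_eq_group_expansion p a G u y]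
  -- write `u` via the mean identity
  have hu' : u = ∑ S ∈ G.powerset, u ^ S.card * (1 - u) ^ (G.card - S.card) * ((S.card : ℝ) / G.card) := by
    have h := sum_groupWeight_mul_card G u
    have e : ∀ S : Finset κ, u ^ S.card * (1 - u) ^ (G.card - S.card) * ((S.card : ℝ) / G.card) =
        (u ^ S.card * (1 - u) ^ (G.card - S.card) * (S.card : ℝ)) / G.card := fun S => by ring
    rw [Finset.sum_congr rfl fun S _ => e S, ← Finset.sum_div, h]
    field_simp
  rw [show (∑ S ∈ G.powerset, u ^ S.card * (1 - u) ^ (G.card - S.card) *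
        ∑ T ∈ ((Finset.univ \ G).powerset).filter (fun T => y ≤ ∑ k ∈ S, a k + ∑ k ∈ T, a k),
          (∏ k ∈ Finset.univ \ G, if k ∈ T then p k else 1 - p k)) - u =
      (∑ S ∈ G.powerset, u ^ S.card * (1 - u) ^ (G.card - S.card) *
        ∑ T ∈ ((Finset.univ \ G).powerset).filter (fun T => y ≤ ∑ k ∈ S, a k + ∑ k ∈ T, a k),
          (∏ k ∈ Finset.univ \ G, if k ∈ T then p k else 1 - p k)) -
      ∑ S ∈ G.powerset, u ^ S.card * (1 - u) ^ (G.card - S.card) * ((S.card : ℝ) / G.card) from by rw [← hu']]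
  rw [← Finset.sum_sub_distrib]
  have e2 : ∀ S : Finset κ, u ^ S.card * (1 - u) ^ (G.card - S.card) *
      ∑ T ∈ ((Finset.univ \ G).powerset).filter (fun T => y ≤ ∑ k ∈ S, a k + ∑ k ∈ T, a k),
        (∏ k ∈ Finset.univ \ G, if k ∈ T then p k else 1 - p k) -
      u ^ S.card * (1 - u) ^ (G.card - S.card) * ((S.card : ℝ) / G.card) =
      u ^ S.card * (1 - u) ^ (G.card - S.card) *
        (∑ T ∈ ((Finset.univ \ G).powerset).filter (fun T => y ≤ ∑ k ∈ S, a k + ∑ k ∈ T, a k),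
          (∏ k ∈ Finset.univ \ G, if k ∈ T then p k else 1 - p k) - (S.card : ℝ) / G.card) := fun S => by ring
  rw [Finset.sum_congr rfl fun S _ => e2 S, Finset.sum_powerset]
  rw [Finset.mul_sum]
  refine Finset.sum_congr rfl fun n hn => ?_
  have hnk : n ≤ G.card := Nat.lt_succ_iff.1 (Finset.mem_range.1 hn)
  rw [Finset.sum_mul, Finset.mul_sum]
  refine Finset.sum_congr rfl fun S hS => ?_
  have hcardS : S.card = n := (Finset.mem_powersetCard.1 hS).2
  rw [hcardS]
  -- `u^n (1−u)^{k−n} = (1−u)^k (u/(1−u))^n`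
  have h1u : (1 - u) ≠ 0 := by linarith
  have hpow : u ^ n * (1 - u) ^ (G.card - n) = (1 - u) ^ G.card * (u / (1 - u)) ^ n := by
    rw [div_pow]
    obtain ⟨d, hd⟩ := Nat.exists_eq_add_of_le hnk
    rw [hd, Nat.add_sub_cancel_left, pow_add]
    field_simp
  rw [hpow]
  ring

/-- **The group raise (reduction R2 of U-REDUCTIONS-G12).**  Gates `p`, integer sizes `a`, a nonempty finset `G` of blobs whose gates are set
to a common value; `0 < t ≤ θ < 1`.  Let `C_n = Σ_{S ⊆ G, #S = n} (Φ(S) − n/#G)` be the level sums of `tail_sub_gate_eq_levelSum` (they do not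
depend on the common gate).  If `(C_n)` is form F — `0 ≤ C_n` for `n ≤ n⋆` and `C_n ≤ 0` for `n > n⋆` — then
`θ ≤ P_θ(y ≤ W)` implies `t ≤ P_t(y ≤ W)`. [this work] -/
theorem group_raise (p : κ → ℝ) (a : κ → ℕ) (G : Finset κ) (hG : G.Nonempty) (t θ : ℝ) (ht0 : 0 < t) (htθ : t ≤ θ)
    (hθ1 : θ < 1) (y : ℕ) (nstar : ℕ)
    (hpos : ∀ n, n ≤ nstar → 0 ≤ ∑ S ∈ G.powersetCard n,
          (∑ T ∈ ((Finset.univ \ G).powerset).filter (fun T => y ≤ ∑ k ∈ S, a k + ∑ k ∈ T, a k),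
              (∏ k ∈ Finset.univ \ G, if k ∈ T then p k else 1 - p k) - (n : ℝ) / G.card))
    (hneg : ∀ n, nstar < n → ∑ S ∈ G.powersetCard n,
          (∑ T ∈ ((Finset.univ \ G).powerset).filter (fun T => y ≤ ∑ k ∈ S, a k + ∑ k ∈ T, a k),
              (∏ k ∈ Finset.univ \ G, if k ∈ T then p k else 1 - p k) - (n : ℝ) / G.card) ≤ 0)
    (hraised : θ ≤ ∑ s ∈ (Finset.univ : Finset (Finset κ)).filter (fun s => y ≤ ∑ k ∈ s, a k),
        (∏ k, if k ∈ s then (fun k => if k ∈ G then θ else p k) k else 1 - (fun k => if k ∈ G then θ else p k) k)) :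
    t ≤ ∑ s ∈ (Finset.univ : Finset (Finset κ)).filter (fun s => y ≤ ∑ k ∈ s, a k),
        (∏ k, if k ∈ s then (fun k => if k ∈ G then t else p k) k else 1 - (fun k => if k ∈ G then t else p k) k) := by
  set C : ℕ → ℝ := fun n => ∑ S ∈ G.powersetCard n,
      (∑ T ∈ ((Finset.univ \ G).powerset).filter (fun T => y ≤ ∑ k ∈ S, a k + ∑ k ∈ T, a k),
          (∏ k ∈ Finset.univ \ G, if k ∈ T then p k else 1 - p k) - (n : ℝ) / G.card) with hC
  have ht1 : t < 1 := lt_of_le_of_lt htθ hθ1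
  have hθ := tail_sub_gate_eq_levelSum p a G hG θ hθ1 y
  have htt := tail_sub_gate_eq_levelSum p a G hG t ht1 y
  set s₁ : ℝ := θ / (1 - θ) with hs₁
  set s₀ : ℝ := t / (1 - t) with hs₀
  have h1θ : 0 < 1 - θ := by linarith
  have h1t : 0 < 1 - t := by linarith
  have hs₀pos : 0 < s₀ := div_pos ht0 h1t
  have hs01 : s₀ ≤ s₁ := by
    rw [hs₀, hs₁, div_le_div_iff₀ h1t h1θ]
    nlinarith
  -- the level-sum polynomial is `≥ 0` at `s₁`
  have hP1 : 0 ≤ ∑ n ∈ Finset.range (G.card + 1), C n * s₁ ^ n := by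
    have hprod : 0 ≤ (1 - θ) ^ G.card * ∑ n ∈ Finset.range (G.card + 1), C n * s₁ ^ n := by
      rw [hC, hs₁, ← hθ]
      linarith
    have hpowpos : 0 < (1 - θ) ^ G.card := pow_pos h1θ _
    nlinarith [hprod, hpowpos, mul_nonneg_iff_of_pos_left hpowpos |>.1 hprod]
  -- transfer to `s₀`
  have hmono := levelSum_ratio_mono C G.card nstar (fun n hn => hpos n hn) (fun n hn => hneg n hn) hs₀pos hs01
  have hP0 : 0 ≤ ∑ n ∈ Finset.range (G.card + 1), C n * s₀ ^ n := by
    have hl : 0 ≤ s₀ ^ nstar * ∑ n ∈ Finset.range (G.card + 1), C n * s₁ ^ n :=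
      mul_nonneg (pow_nonneg (le_of_lt hs₀pos) _) hP1
    have hs1pow : 0 < s₁ ^ nstar := pow_pos (lt_of_lt_of_le hs₀pos hs01) _
    have := le_trans hl hmono
    exact (mul_nonneg_iff_of_pos_left hs1pow).1 this
  have hfinal : 0 ≤ (1 - t) ^ G.card * ∑ n ∈ Finset.range (G.card + 1), C n * s₀ ^ n :=
    mul_nonneg (pow_nonneg (le_of_lt h1t) _) hP0
  rw [hC, hs₀, ← htt] at hfinal
  linarith

end IndepBlob

end Quant

end Summit.CriticalPhenomena.PercolationContinuityZ3.Theorems
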